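import Summits.CriticalPhenomena.SAWScalingLimit.Theorems.SAWLoopFugacityFlowIsingBoundaryRatioWindowResistanceDefs
import Literature.Probability.LatticeModels.DiscreteExtremalLengthExternalArcsProofs
import Literature.Analysis.Complex.ExtremalLength
import HarnessLib

/-!
# Resistance bound for the window rectangle — Chelkak's length comparison
(line `fk-anchor-transfer`, crux `IsingBoundaryRatio`, stmt-CriticalPhenomena-10650; helper module of the proof of
`WindowExtResistanceBound`, `…IsingBoundaryRatioWindowResistanceDefs.lean`)

The discrete-versus-continuous length comparison of D. Chelkak, *Robust discrete complex analysis: a toolbox*,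
Ann. Probab. 44 (2016), proof of Prop. 6.2 (i) ("it is easy to construct a nearest-neighbour lattice path
`γ^δ` running along `γ` such that `Length_g(γ^δ) ≤ const · Length_{ĝ}(γ)`"), for the completed graph
`Ω̄ = DiscreteRect.extGraph E` and the block metric `ĝ(z) = Σ_{x ∈ verts E} w(x) 𝟙[dist(z, δx) ≤ 6δ]`,
`w(x) = Σ_{e ∋ inl x} W(e)` (written inline):

* `wer_edgeDist_mul_le` — if a walk of `Ω̄` from `A` to `Z` has all its lattice vertices within `5δ` of a
  curve `γ` (continuous and differentiable on an open parameter interval) of euclidean diameter `> 12δ`, then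
  `dist_W(A, Z) · δ ≤ ∫ ĝ(γ(t)) ‖γ'(t)‖ dt`. Indeed `dist_W ≤` the `W`-length of the de-duplicated path
  (`Walk.bypass`) `≤ Σ_x w(x)` over its lattice vertices (`wer_walkLength_le_sum`: every edge of `Ω̄` contains
  a lattice vertex), and for each such `x` the curve crosses the collar `{5δ ≤ dist(·, δx) ≤ 6δ}`, which costs
  euclidean length `≥ δ` inside the ball (`wer_ofReal_le_lintegral_ball`: first exit / last entrance and
  `‖γ(v) - γ(u)‖ ≤ ∫ᵤᵛ ‖γ'‖`, `wer_enorm_sub_le_lintegral`).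

All statements are folklore real analysis / bookkeeping.
-/

noncomputable section

open scoped Classical Topology ENNReal NNReal
open Filter Set Metric SimpleGraph MeasureTheory
open Literature.Probability.LatticeModels Literature.Probability.RandomPlanarGeometry
open Literature.Probability.Percolation (BondConfig)
open UpperHalfPlane (upperHalfPlaneSet)

namespace Summit.CriticalPhenomena.SAWScalingLimit.Theorems.IsingBoundaryRatio

/-- **`‖γ(v) - γ(u)‖ ≤ ∫ᵤᵛ ‖γ'‖`** for a path continuous on `[u, v]` and differentiable on `(u, v)`. [folklore] -/
theorem wer_enorm_sub_le_lintegral {γ : ℝ → ℂ} {u v : ℝ} (huv : u < v) (hc : ContinuousOn γ (Icc u v))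
    (hd : ∀ t ∈ Ioo u v, DifferentiableAt ℝ γ t) :
    ‖γ v - γ u‖ₑ ≤ ∫⁻ t in Ioo u v, ‖deriv γ t‖ₑ := by
  by_cases htop : ∫⁻ t in Ioo u v, ‖deriv γ t‖ₑ = ∞
  · rw [htop]; exact le_top
  have hint : IntegrableOn (deriv γ) (Ioo u v) :=
    ⟨(measurable_deriv γ).aestronglyMeasurable, lt_top_iff_ne_top.2 htop⟩
  have hint' : IntervalIntegrable (deriv γ) volume u v :=
    (intervalIntegrable_iff_integrableOn_Ioo_of_le huv.le).2 hint
  have hftc := intervalIntegral.integral_eq_sub_of_hasDerivAt_of_le huv.le hc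
    (fun t ht => (hd t ht).hasDerivAt) hint'
  have hle : ‖γ v - γ u‖ ≤ (∫⁻ t in Ioo u v, ‖deriv γ t‖ₑ).toReal := by
    rw [← hftc, intervalIntegral.integral_of_le huv.le, integral_Ioc_eq_integral_Ioo,
      ← integral_norm_eq_lintegral_enorm hint.aestronglyMeasurable]
    exact norm_integral_le_integral_norm _
  calc ‖γ v - γ u‖ₑ = ENNReal.ofReal ‖γ v - γ u‖ := (ofReal_norm _).symm
    _ ≤ ENNReal.ofReal ((∫⁻ t in Ioo u v, ‖deriv γ t‖ₑ).toReal) := ENNReal.ofReal_le_ofReal hle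
    _ ≤ ∫⁻ t in Ioo u v, ‖deriv γ t‖ₑ := ENNReal.ofReal_toReal_le

/-- First exit from an open ball along a continuous path (forward in time). [folklore] -/
theorem wer_exists_exit_fwd {γ : ℝ → ℂ} {t₀ t₁ : ℝ} (h01 : t₀ < t₁) (hc : ContinuousOn γ (Icc t₀ t₁)) {m : ℂ}
    {R : ℝ} (h0 : dist (γ t₀) m < R) (h1 : R ≤ dist (γ t₁) m) :
    ∃ s ∈ Ioc t₀ t₁, (∀ t ∈ Ico t₀ s, dist (γ t) m < R) ∧ R ≤ dist (γ s) m := by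
  set T : Set ℝ := Icc t₀ t₁ ∩ {t | R ≤ dist (γ t) m} with hT
  have hTc : IsClosed T := by
    have : ContinuousOn (fun t => dist (γ t) m) (Icc t₀ t₁) :=
      (continuous_id.dist continuous_const).comp_continuousOn hc
    exact this.preimage_isClosed_of_isClosed isClosed_Icc isClosed_Ici
  have hTne : T.Nonempty := ⟨t₁, right_mem_Icc.2 h01.le, h1⟩
  have hTbdd : BddBelow T := ⟨t₀, fun t ht => ht.1.1⟩
  set s := sInf T with hs
  have hsT : s ∈ T := hTc.csInf_mem hTne hTbdd
  have hs0 : t₀ < s := by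
    rcases hsT.1.1.eq_or_lt with h | h
    · exfalso
      have := hsT.2
      rw [← h] at this
      exact absurd this (not_le.2 h0)
    · exact h
  refine ⟨s, ⟨hs0, hsT.1.2⟩, fun t ht => ?_, hsT.2⟩
  by_contra hlt
  push Not at hlt
  have : s ≤ t := csInf_le hTbdd ⟨⟨ht.1, ht.2.le.trans hsT.1.2⟩, hlt⟩
  exact absurd this (not_le.2 ht.2)

/-- Last entrance into an open ball along a continuous path (backward in time). [folklore] -/
theorem wer_exists_exit_bwd {γ : ℝ → ℂ} {t₀ t₁ : ℝ} (h10 : t₁ < t₀) (hc : ContinuousOn γ (Icc t₁ t₀)) {m : ℂ}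
    {R : ℝ} (h0 : dist (γ t₀) m < R) (h1 : R ≤ dist (γ t₁) m) :
    ∃ s ∈ Ico t₁ t₀, (∀ t ∈ Ioc s t₀, dist (γ t) m < R) ∧ R ≤ dist (γ s) m := by
  set T : Set ℝ := Icc t₁ t₀ ∩ {t | R ≤ dist (γ t) m} with hT
  have hTc : IsClosed T := by
    have : ContinuousOn (fun t => dist (γ t) m) (Icc t₁ t₀) :=
      (continuous_id.dist continuous_const).comp_continuousOn hc
    exact this.preimage_isClosed_of_isClosed isClosed_Icc isClosed_Ici
  have hTne : T.Nonempty := ⟨t₁, left_mem_Icc.2 h10.le, h1⟩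
  have hTbdd : BddAbove T := ⟨t₀, fun t ht => ht.1.2⟩
  set s := sSup T with hs
  have hsT : s ∈ T := hTc.csSup_mem hTne hTbdd
  have hs0 : s < t₀ := by
    rcases hsT.1.2.eq_or_lt with h | h
    · exfalso
      have := hsT.2
      rw [h] at this
      exact absurd this (not_le.2 h0)
    · exact h
  refine ⟨s, ⟨hsT.1.1, hs0⟩, fun t ht => ?_, hsT.2⟩
  by_contra hlt
  push Not at hlt
  have : t ≤ s := le_csSup hTbdd ⟨⟨hsT.1.1.trans ht.1.le, ht.2⟩, hlt⟩
  exact absurd this (not_le.2 ht.1)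

/-- **A curve that comes within `5δ` of a point and also leaves its `6δ`-ball has euclidean length at
least `δ` inside the closed `6δ`-ball.** [folklore] -/
theorem wer_ofReal_le_lintegral_ball {γ : ℝ → ℂ} {a b : ℝ} (hγc : ContinuousOn γ (Ioo a b))
    (hγd : DifferentiableOn ℝ γ (Ioo a b)) {m : ℂ} {δ : ℝ} {t₀ t₁ : ℝ} (ht₀ : t₀ ∈ Ioo a b)
    (ht₁ : t₁ ∈ Ioo a b) (h0 : dist (γ t₀) m ≤ 5 * δ) (h1 : 6 * δ < dist (γ t₁) m) :
    ENNReal.ofReal δ ≤ ∫⁻ t in Ioo a b, (closedBall m (6 * δ)).indicator (fun _ => (1 : ℝ≥0∞)) (γ t) * ‖deriv γ t‖ₑ := by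
  rcases le_or_gt δ 0 with hδ0 | hδ0
  · rw [ENNReal.ofReal_of_nonpos hδ0]; exact zero_le
  have hδ : 5 * δ < 6 * δ := by linarith
  have key : ∀ {u v : ℝ}, a < u → u < v → v < b → (∀ t ∈ Ioo u v, dist (γ t) m < 6 * δ) →
      ‖γ v - γ u‖ₑ ≤ ∫⁻ t in Ioo a b, (closedBall m (6 * δ)).indicator (fun _ => (1 : ℝ≥0∞)) (γ t) * ‖deriv γ t‖ₑ := by
    intro u v hau huv hvb hin
    have hsub : Icc u v ⊆ Ioo a b := fun t ht => ⟨hau.trans_le ht.1, ht.2.trans_lt hvb⟩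
    calc ‖γ v - γ u‖ₑ ≤ ∫⁻ t in Ioo u v, ‖deriv γ t‖ₑ :=
          wer_enorm_sub_le_lintegral huv (hγc.mono hsub)
            fun t ht => hγd.differentiableAt (Ioo_mem_nhds (hau.trans ht.1) (ht.2.trans hvb))
      _ = ∫⁻ t in Ioo u v, (closedBall m (6 * δ)).indicator (fun _ => (1 : ℝ≥0∞)) (γ t) * ‖deriv γ t‖ₑ := by
          refine setLIntegral_congr_fun measurableSet_Ioo fun t ht => ?_
          rw [Set.indicator_of_mem (Metric.mem_closedBall.2 (hin t ht).le), one_mul]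
      _ ≤ _ := lintegral_mono_set (Ioo_subset_Ioo hau.le hvb.le)
  have htri : ∀ {s : ℝ}, 6 * δ ≤ dist (γ s) m → ENNReal.ofReal δ ≤ ‖γ s - γ t₀‖ₑ ∧ ENNReal.ofReal δ ≤ ‖γ t₀ - γ s‖ₑ := by
    intro s hs
    have h : δ ≤ dist (γ s) (γ t₀) := by linarith [dist_triangle (γ s) (γ t₀) m]
    constructor
    · rw [← ofReal_norm, ← dist_eq_norm]; exact ENNReal.ofReal_le_ofReal h
    · rw [← ofReal_norm, ← dist_eq_norm, _root_.dist_comm]; exact ENNReal.ofReal_le_ofReal h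
  rcases lt_or_gt_of_ne (show t₀ ≠ t₁ from fun h => by rw [h] at h0; linarith) with hlt | hlt
  · obtain ⟨s, hs, hin, hsR⟩ := wer_exists_exit_fwd hlt
      (hγc.mono fun t ht => ⟨ht₀.1.trans_le ht.1, ht.2.trans_lt ht₁.2⟩) (h0.trans_lt hδ) h1.le
    exact (htri hsR).1.trans (key ht₀.1 hs.1 (hs.2.trans_lt ht₁.2) fun t ht => hin t ⟨ht.1.le, ht.2⟩)
  · obtain ⟨s, hs, hin, hsR⟩ := wer_exists_exit_bwd hlt
      (hγc.mono fun t ht => ⟨ht₁.1.trans_le ht.1, ht.2.trans_lt ht₀.2⟩) (h0.trans_lt hδ) h1.le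
    exact (htri hsR).2.trans (key (ht₁.1.trans_le hs.1) hs.2 ht₀.2 fun t ht => hin t ⟨ht.1, ht.2.le⟩)

/-- Every edge of a walk of `Ω̄` contains a lattice vertex of the walk. [folklore] -/
theorem wer_exists_inl_of_mem_edges {E : Finset (Sym2 (Site 2))} {u v : Site 2 ⊕ Site 2 × Fin 4}
    (p : (DiscreteRect.extGraph E).Walk u v) {e : Sym2 (Site 2 ⊕ Site 2 × Fin 4)} (he : e ∈ p.edges) :
    ∃ x ∈ DiscreteRect.verts E, Sum.inl x ∈ p.support ∧ Sum.inl x ∈ e := by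
  revert he
  induction e using Sym2.ind with
  | h a b =>
    intro he
    have hadj : (DiscreteRect.extGraph E).Adj a b := p.edges_subset_edgeSet he
    have ha : a ∈ p.support := p.fst_mem_support_of_mem_edges he
    have hb : b ∈ p.support := p.snd_mem_support_of_mem_edges he
    cases a with
    | inl x =>
      refine ⟨x, ?_, ha, Sym2.mem_mk_left _ _⟩
      cases b with
      | inl y =>
        have h := (DiscreteRect.extGraph_adj_inl_inl.1 hadj).2
        rw [Sym2.eq_swap] at h
        exact DiscreteRect.mem_verts_of_mem h
      | inr d => exact (DiscreteRect.extGraph_adj_inl_inr.1 hadj).2 ▸ (DiscreteRect.extGraph_adj_inl_inr.1 hadj).1.1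
    | inr d =>
      cases b with
      | inl x =>
        refine ⟨x, ?_, hb, Sym2.mem_mk_right _ _⟩
        have hadj' := hadj.symm
        exact (DiscreteRect.extGraph_adj_inl_inr.1 hadj').2 ▸ (DiscreteRect.extGraph_adj_inl_inr.1 hadj').1.1
      | inr d' => exact absurd hadj DiscreteRect.extGraph_not_adj_inr_inr

/-- **The length of a path is at most the sum over its lattice vertices `x` of the total weight
`w(x) = Σ_{e ∋ x} W(e)` of the edges at `x`.** [folklore] -/
theorem wer_walkLength_le_sum {E : Finset (Sym2 (Site 2))} {F : Finset (Sym2 (Site 2 ⊕ Site 2 × Fin 4))}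
    (hF : ∀ e ∈ (DiscreteRect.extGraph E).edgeSet, e ∈ F) (W : Sym2 (Site 2 ⊕ Site 2 × Fin 4) → ℝ≥0)
    {u v : Site 2 ⊕ Site 2 × Fin 4} (p : (DiscreteRect.extGraph E).Walk u v) (hp : p.IsPath) :
    walkLength W p ≤ ∑ x ∈ (DiscreteRect.verts E).filter (fun x => Sum.inl x ∈ p.support),
      ∑ e ∈ F with Sum.inl x ∈ e, W e := by
  set X := (DiscreteRect.verts E).filter (fun x => Sum.inl x ∈ p.support) with hX
  have hnd : p.edges.Nodup := Walk.edges_nodup_of_support_nodup hp.support_nodup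
  have h1 : walkLength W p = ∑ e ∈ p.edges.toFinset, W e := by
    rw [walkLength, List.sum_toFinset _ hnd]
  rw [h1]
  calc ∑ e ∈ p.edges.toFinset, W e
      ≤ ∑ e ∈ p.edges.toFinset, ∑ x ∈ X, (if Sum.inl x ∈ e then W e else 0) := by
        refine Finset.sum_le_sum fun e he => ?_
        rw [List.mem_toFinset] at he
        obtain ⟨x, hxv, hxs, hxe⟩ := wer_exists_inl_of_mem_edges p he
        have hxX : x ∈ X := Finset.mem_filter.2 ⟨hxv, hxs⟩
        calc W e = (if Sum.inl x ∈ e then W e else 0) := by rw [if_pos hxe]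
          _ ≤ ∑ x ∈ X, (if Sum.inl x ∈ e then W e else 0) :=
            Finset.single_le_sum (f := fun x => if Sum.inl x ∈ e then W e else 0) (fun _ _ => zero_le) hxX
    _ ≤ ∑ e ∈ F, ∑ x ∈ X, (if Sum.inl x ∈ e then W e else 0) := by
        refine Finset.sum_le_sum_of_subset_of_nonneg (fun e he => ?_) (fun _ _ _ => zero_le)
        rw [List.mem_toFinset] at he
        exact hF e (p.edges_subset_edgeSet he)
    _ = ∑ x ∈ X, ∑ e ∈ F with Sum.inl x ∈ e, W e := by
        rw [Finset.sum_comm]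
        refine Finset.sum_congr rfl fun x _ => ?_
        rw [Finset.sum_filter]

/-- **Length comparison** (Chelkak 2016, proof of Prop. 6.2 (i): `Length_g(γ^δ) ≤ const · Length_{ĝ}(γ)`):
if a walk of `Ω̄` from `A` to `Z` has all its lattice vertices within `5δ` of a curve `γ` of euclidean
diameter `> 12δ`, then `dist_W(A, Z) · δ ≤ ∫_γ ĝ |dz|` for the block metric
`ĝ(z) = Σ_x w(x) 𝟙[|z - δx| ≤ 6δ]`. [folklore] -/
theorem wer_edgeDist_mul_le {E : Finset (Sym2 (Site 2))} {F : Finset (Sym2 (Site 2 ⊕ Site 2 × Fin 4))}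
    (hF : ∀ e ∈ (DiscreteRect.extGraph E).edgeSet, e ∈ F) (W : Sym2 (Site 2 ⊕ Site 2 × Fin 4) → ℝ≥0)
    {δ : ℝ} {γ : ℝ → ℂ} {a b : ℝ} (hγc : ContinuousOn γ (Ioo a b)) (hγd : DifferentiableOn ℝ γ (Ioo a b))
    (hfar : ∃ t₁ ∈ Ioo a b, ∃ t₂ ∈ Ioo a b, 12 * δ < dist (γ t₁) (γ t₂))
    {A Z : Set (Site 2 ⊕ Site 2 × Fin 4)} {u v : Site 2 ⊕ Site 2 × Fin 4} (hu : u ∈ A) (hv : v ∈ Z)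
    (p : (DiscreteRect.extGraph E).Walk u v)
    (hnear : ∀ x : Site 2, Sum.inl x ∈ p.support → ∃ t ∈ Ioo a b, dist (γ t) (meshPoint δ x) ≤ 5 * δ) :
    edgeDist (DiscreteRect.extGraph E) W A Z * ENNReal.ofReal δ ≤
      ∫⁻ t in Ioo a b, (∑ x ∈ DiscreteRect.verts E, (closedBall (meshPoint δ x) (6 * δ)).indicator
        (fun _ => ((∑ e ∈ F with Sum.inl x ∈ e, W e : ℝ≥0) : ℝ≥0∞)) (γ t)) * ‖deriv γ t‖ₑ := by
  set q := p.bypass with hq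
  have hqp : q.IsPath := p.bypass_isPath
  set X := (DiscreteRect.verts E).filter (fun x => Sum.inl x ∈ q.support) with hX
  set w : Site 2 → ℝ≥0 := fun x => ∑ e ∈ F with Sum.inl x ∈ e, W e with hw
  have hXV : X ⊆ DiscreteRect.verts E := Finset.filter_subset _ _
  -- each lattice vertex of the path contributes a crossing of its ball
  have hball : ∀ x ∈ X, ENNReal.ofReal δ ≤
      ∫⁻ t in Ioo a b, (closedBall (meshPoint δ x) (6 * δ)).indicator (fun _ => (1 : ℝ≥0∞)) (γ t) * ‖deriv γ t‖ₑ := by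
    intro x hx
    obtain ⟨t₀, ht₀, hd₀⟩ := hnear x (p.support_bypass_subset_support (Finset.mem_filter.1 hx).2)
    obtain ⟨t₁, ht₁, t₂, ht₂, hfar'⟩ := hfar
    by_cases h1 : 6 * δ < dist (γ t₁) (meshPoint δ x)
    · exact wer_ofReal_le_lintegral_ball hγc hγd ht₀ ht₁ hd₀ h1
    · push Not at h1
      have h2 : 6 * δ < dist (γ t₂) (meshPoint δ x) := by
        by_contra h2
        push Not at h2
        linarith [dist_triangle (γ t₁) (meshPoint δ x) (γ t₂), _root_.dist_comm (γ t₂) (meshPoint δ x)]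
      exact wer_ofReal_le_lintegral_ball hγc hγd ht₀ ht₂ hd₀ h2
  have hmeas' : ∀ x ∈ X, AEMeasurable (fun t =>
      ((closedBall (meshPoint δ x) (6 * δ)).indicator (fun _ => (1 : ℝ≥0∞)) (γ t) * ‖deriv γ t‖ₑ))
      (volume.restrict (Ioo a b)) := by
    intro x _
    exact ((measurable_const.indicator measurableSet_closedBall).comp_aemeasurable
      (hγc.aemeasurable measurableSet_Ioo)).mul (measurable_deriv γ).enorm.aemeasurable
  have hmeas : ∀ x ∈ X, AEMeasurable (fun t => (w x : ℝ≥0∞) *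
      ((closedBall (meshPoint δ x) (6 * δ)).indicator (fun _ => (1 : ℝ≥0∞)) (γ t) * ‖deriv γ t‖ₑ))
      (volume.restrict (Ioo a b)) := fun x hx => (hmeas' x hx).const_mul _
  calc edgeDist (DiscreteRect.extGraph E) W A Z * ENNReal.ofReal δ
      ≤ (walkLength W q : ℝ≥0∞) * ENNReal.ofReal δ := by
        gcongr; exact edgeDist_le_walkLength W hu hv q
    _ ≤ (∑ x ∈ X, (w x : ℝ≥0∞)) * ENNReal.ofReal δ := by
        gcongr; exact_mod_cast wer_walkLength_le_sum hF W q hqp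
    _ = ∑ x ∈ X, (w x : ℝ≥0∞) * ENNReal.ofReal δ := Finset.sum_mul _ _ _
    _ ≤ ∑ x ∈ X, (w x : ℝ≥0∞) * ∫⁻ t in Ioo a b,
          (closedBall (meshPoint δ x) (6 * δ)).indicator (fun _ => (1 : ℝ≥0∞)) (γ t) * ‖deriv γ t‖ₑ := by
        gcongr with x hx; exact hball x hx
    _ = ∫⁻ t in Ioo a b, ∑ x ∈ X, (w x : ℝ≥0∞) *
          ((closedBall (meshPoint δ x) (6 * δ)).indicator (fun _ => (1 : ℝ≥0∞)) (γ t) * ‖deriv γ t‖ₑ) := by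
        rw [lintegral_finsetSum' _ hmeas]
        refine Finset.sum_congr rfl fun x hx => ?_
        rw [lintegral_const_mul'' _ (hmeas' x hx)]
    _ ≤ _ := by
        refine lintegral_mono fun t => ?_
        rw [Finset.sum_mul]
        calc ∑ x ∈ X, (w x : ℝ≥0∞) *
              ((closedBall (meshPoint δ x) (6 * δ)).indicator (fun _ => (1 : ℝ≥0∞)) (γ t) * ‖deriv γ t‖ₑ)
            = ∑ x ∈ X, (closedBall (meshPoint δ x) (6 * δ)).indicator (fun _ => (w x : ℝ≥0∞)) (γ t) * ‖deriv γ t‖ₑ := by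
              refine Finset.sum_congr rfl fun x _ => ?_
              simp only [Set.indicator_apply]
              split_ifs <;> simp
          _ ≤ ∑ x ∈ DiscreteRect.verts E,
              (closedBall (meshPoint δ x) (6 * δ)).indicator (fun _ => (w x : ℝ≥0∞)) (γ t) * ‖deriv γ t‖ₑ :=
              Finset.sum_le_sum_of_subset hXV

/-- `wer_enorm_sub_le_lintegral`, closed form (registered sub-goal of stmt-CriticalPhenomena-10650). [folklore] -/
theorem wer_enorm_sub_le_lintegral' : ∀ {γ : ℝ → ℂ} {u v : ℝ}, u < v → ContinuousOn γ (Icc u v) → (∀ t ∈ Ioo u v, DifferentiableAt ℝ γ t) → ‖γ v - γ u‖ₑ ≤ ∫⁻ t in Ioo u v, ‖deriv γ t‖ₑ :=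
  fun huv hc hd => wer_enorm_sub_le_lintegral huv hc hd

end Summit.CriticalPhenomena.SAWScalingLimit.Theorems.IsingBoundaryRatio

end
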